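import Literature.Probability.FitznerVanDerHofstad2017.NobleKSpaceRewriteFRem
import HarnessLib

/-!
# [NoBLE17] App. D (D.29): the weighted `ℓ¹` bound `Σ_x ‖x‖₂² |R_F(x)| ≤ β_{|ΔR,F|}` — proved

[NoBLE17] = Fitzner–van der Hofstad, *Generalized approach to the non-backtracking lace expansion*,
PTRF 169 (2017), Prop. 4.5 and App. D, Step 4 ((D.22)–(D.29), pp. 1115–1116).

`NobleKSpaceRewriteFRem` constructs the remainder `R_F = nobleFRem S` of the rewrite (1.26) of the NoBLE equation,
splits it into six terms per direction (`nobleFRemT1 … T6`, (D.30)–(D.31)) and builds the ONE-SIDED (parity-selected)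
majorant `m` of Step 5 with `−m ≤ R_F` and `Σ ‖x‖₂² m(x) ≤ β̲^{corr}_{ΔR,F}` ((D.32)).  This module carries out Step 4
itself: the TWO-SIDED majorant `m^{abs}` ("we use `x_i² ≥ 0` and bound each matrix elements from below [Step 5] /
in absolute value [Step 4]"), obtained from the same six terms by dropping the parity selection —
`|Ψ^{[even]} − Ψ^{[odd]}| ≤ Ψ^{[even]} + Ψ^{[odd]} ≤ β_{μ̄/μ} Ξ^{[abs]}`, `|Π^{ι,κ}| ≤ μ̄ Ξ^{[abs],ι}` ((4.29), (D.24)) —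
with `|R_F| ≤ m^{abs}` pointwise (`abs_nobleFRem_le_absMaj`) and the weighted moment bound of `m^{abs}` computed by
the bookkeeping of (D.25)–(D.28) (`MomentBound.lconv`, `sum_dir_comp_add_stepVec`).  The resulting displacement
constant `nobleAbsMajW d i` IS the notebook's `betaRfDelta` as wired into `BetaMap.extraOfInputs d i 4`
(`nobleAbsMajW_eq`, a `field_simp; ring` identity under `μ < 1`, `t < 1`): (D.29) holds VERBATIM for the coded
constant, with no side condition beyond the well-formedness clause `NobleInputsWF` (`t = 2dμ̄β_{Ξ^ι}/(1−μ) < 1`).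

Main results: `nobleFRem_weighted_le` (`Σ ‖x‖₂²|R_F| ≤ nobleAbsMajW d i`), `nobleAbsMajW_eq`,
`nobleFRem_weighted` (`… ≤ BetaMap.extraOfInputs d i 4`, the hypothesis (D.29) of
`nobleSimplifiedFormF3At_of_assumptions₆/₇`).  Additive: no existing module is modified; imports only the built
module `NobleKSpaceRewriteFRem`.
-/

namespace Literature.Probability.FitznerVanDerHofstad2017

open scoped BigOperators
open Literature.Probability.LatticeModels
open Literature.Probability.Percolation
open Literature.Barriers.CriticalPhenomena
open Literature.Probability.RandomPlanarGeometry.SAW.Zd (normSq)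

variable {d : ℕ}

/-! ## Part A. The two-sided majorant `m^{abs}` of `R_F` ([NoBLE17] App. D Step 4) -/

section AbsMajorant

local notation "𝐞" => Literature.Probability.Percolation.stepVec

variable {p : unitInterval} {P X : ℝ} {i : BetaMap.Inputs} {S : NobleSplit d p}

/-- Two-sided majorant of term 2 (direction `ι`): `μβ_{μ̄/μ}(1−μ²)⁻¹((Ξ^{[even≥2]}+Ξ^{[odd≥3]})(x+e_ι) + μ(Ξ^{[even≥2]}+Ξ^{[odd≥3]})(x))`
(the `N ≥ 2` classes of `Ψ^ι`, both parities). [cite: FitznerVanDerHofstad2016NoBLE, App. D (D.24), (D.29) line 4 (`β_{ΨΞ}Σ_{N≥2}`) (pp. 1115–1116)] -/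
noncomputable def nobleAbsM2 (d : ℕ) (p : unitInterval) (i : BetaMap.Inputs) (ι : Fin d × Bool) (x : Site d) : ℝ :=
  i.mu * i.mubOverMu * (1 - i.mu ^ 2)⁻¹ *
    ((nobleXiCls d p (fun N => 2 * N + 2) (x + 𝐞 ι) + nobleXiCls d p (fun N => 2 * N + 3) (x + 𝐞 ι)) +
      i.mu * (nobleXiCls d p (fun N => 2 * N + 2) x + nobleXiCls d p (fun N => 2 * N + 3) x))

/-- Two-sided majorant of term 3 (direction `ι`): `μ(1−μ²)⁻¹((Ψ^{(0)}_{R,I}+Ψ^{(1)}_{R,I})(x+e_ι) + μ(Ψ^{(0)}_{R,II}+Ψ^{(1)}_{R,II})(x))`.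
[cite: FitznerVanDerHofstad2016NoBLE, Assumption 4.3 (4.44)–(4.45) (p. 1087); App. D (D.29) line 4 (p. 1116)] -/
noncomputable def nobleAbsM3 (S : NobleSplit d p) (i : BetaMap.Inputs) (ι : Fin d × Bool) (x : Site d) : ℝ :=
  i.mu * (1 - i.mu ^ 2)⁻¹ *
    ((S.psiRI 0 ι (x + 𝐞 ι) + S.psiRI 1 ι (x + 𝐞 ι)) + i.mu * (S.psiRII 0 ι x + S.psiRII 1 ι x))

/-- Two-sided majorant of term 4 (direction `ι`): `μ(1−μ²)⁻²Σ_κ(Π^{(0),ι,κ}_R + μ̄(Ξ^{[odd],ι}+Ξ^{[even≥2],ι}))(x+e_ι+e_κ)`.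
[cite: FitznerVanDerHofstad2016NoBLE, Assumption 4.3 (4.48) (p. 1088); App. D (D.24), (D.29) line 5 (pp. 1115–1116)] -/
noncomputable def nobleAbsM4 (S : NobleSplit d p) (i : BetaMap.Inputs) (ι : Fin d × Bool) (x : Site d) : ℝ :=
  i.mu * ((1 - i.mu ^ 2)⁻¹) ^ 2 *
    ((∑ κ : Fin d × Bool, S.piR ι κ (x + 𝐞 ι + 𝐞 κ)) +
      i.mub * ∑ κ : Fin d × Bool, (nobleXiIotaCls d p (fun N => 2 * N + 1) (𝐞 ι) (x + 𝐞 κ + 𝐞 ι) +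
        nobleXiIotaCls d p (fun N => 2 * N + 2) (𝐞 ι) (x + 𝐞 κ + 𝐞 ι)))

/-- Two-sided majorant of term 5 (direction `ι`): `μ²μ̄(1−μ²)⁻²Σ_κ(Ξ^{[abs],−ι}(x+e_κ) + Ξ^{[abs],ι}(x+e_ι) + μΞ^{[abs],−ι}(x))`.
[cite: FitznerVanDerHofstad2016NoBLE, App. D (D.24), (D.29) line 6 (pp. 1115–1116)] -/
noncomputable def nobleAbsM5 (d : ℕ) (p : unitInterval) (i : BetaMap.Inputs) (ι : Fin d × Bool) (x : Site d) : ℝ :=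
  i.mu ^ 2 * i.mub * ((1 - i.mu ^ 2)⁻¹) ^ 2 *
    ∑ κ : Fin d × Bool, (nobleXiIotaCls d p (fun N => N) (𝐞 (srev ι)) (x + 𝐞 κ) +
      nobleXiIotaCls d p (fun N => N) (𝐞 ι) (x + 𝐞 ι) + i.mu * nobleXiIotaCls d p (fun N => N) (𝐞 (srev ι)) x)

/-- `B^{abs}_ι(z) := Σ_κ (Ξ^{[abs],ι}(z+e_κ+e_ι) + μΞ^{[abs],−ι}(z+e_κ) + μΞ^{[abs],ι}(z+e_ι) + μ²Ξ^{[abs],−ι}(z))` — the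
two-sided majorant of `(1−μ²)² μ̄⁻¹ (A u)_ι`. [cite: FitznerVanDerHofstad2016NoBLE, App. D (D.24)–(D.28) (pp. 1115–1116)] -/
noncomputable def nobleAbsB (d : ℕ) (p : unitInterval) (i : BetaMap.Inputs) (ι : Fin d × Bool) (z : Site d) : ℝ :=
  ∑ κ : Fin d × Bool, (nobleXiIotaCls d p (fun N => N) (𝐞 ι) (z + 𝐞 κ + 𝐞 ι) +
    i.mu * nobleXiIotaCls d p (fun N => N) (𝐞 (srev ι)) (z + 𝐞 κ) +
    i.mu * nobleXiIotaCls d p (fun N => N) (𝐞 ι) (z + 𝐞 ι) + i.mu ^ 2 * nobleXiIotaCls d p (fun N => N) (𝐞 (srev ι)) z)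

/-- Two-sided majorant of term 6 (direction `ι`): `μβ_{μ̄/μ} μ̄ (1−μ²)⁻² (Ξ^{[abs]} ⋆ B^{abs}_ι)`.
[cite: FitznerVanDerHofstad2016NoBLE, App. D (D.24)–(D.28), (D.29) line 7 (pp. 1115–1116)] -/
noncomputable def nobleAbsM6 (d : ℕ) (p : unitInterval) (i : BetaMap.Inputs) (ι : Fin d × Bool) (x : Site d) : ℝ :=
  i.mu * i.mubOverMu * i.mub * ((1 - i.mu ^ 2)⁻¹) ^ 2 * lconv (nobleXiCls d p fun N => N) (nobleAbsB d p i ι) x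

/-- **The two-sided majorant `m^{abs}`** of `R_F`: `M₁ + Σ_ι (M^{abs}_{2,ι} + … + M^{abs}_{6,ι})` (`M₁ = μτ₂ + μβ_{μ̄/μ}Ξ^{[abs]}⋆τ₂`
already two-sided). [cite: FitznerVanDerHofstad2016NoBLE, App. D Step 4 (D.22)–(D.29) (pp. 1115–1116)] -/
noncomputable def nobleAbsMaj (S : NobleSplit d p) (i : BetaMap.Inputs) (x : Site d) : ℝ :=
  nobleMajM1 d p i x + ∑ ι : Fin d × Bool,
    (nobleAbsM2 d p i ι x + nobleAbsM3 S i ι x + nobleAbsM4 S i ι x + nobleAbsM5 d p i ι x + nobleAbsM6 d p i ι x)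

/-- **The displacement constant of `m^{abs}`** produced by the bookkeeping (a closed form in the record `i`).
[cite: FitznerVanDerHofstad2016NoBLE, App. D (D.29) (p. 1116)] -/
noncomputable def nobleAbsMajW (d : ℕ) (i : BetaMap.Inputs) : ℝ :=
  i.mu * nobleMajW2 d i + i.mu * i.mubOverMu * (i.xiDeltaAbs * nobleMajA2 d i + i.xiAbs * nobleMajW2 d i) +
    (i.mu * i.mubOverMu * (1 - i.mu ^ 2)⁻¹ *
          (2 * d * ((i.xiEvenTailDelta + i.xiOddTailDelta) + (i.xiEvenTail + i.xiOddTail)) +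
            i.mu * (2 * d * (i.xiEvenTailDelta + i.xiOddTailDelta))) +
        2 * d * (i.mu * (1 - i.mu ^ 2)⁻¹ *
          ((i.psiRI0Delta + i.psiRI1Delta) + i.mu * (i.psiRII0Delta + i.psiRII1Delta))) +
        i.mu * ((1 - i.mu ^ 2)⁻¹) ^ 2 *
          (i.piR0DeltaEiEk + i.mub * (2 * d * (2 * d *
            ((i.xiIotaOddDeltaEi + i.xiIotaEvenTailDeltaEi) + (i.xiIotaOdd + i.xiIotaEvenTail))))) +
        2 * d * (i.mu ^ 2 * i.mub * ((1 - i.mu ^ 2)⁻¹) ^ 2 *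
          (2 * d * (i.xiIotaDeltaZero + i.xiIotaAbs) + 2 * d * i.xiIotaDeltaEi + 2 * d * (i.mu * i.xiIotaDeltaZero))) +
        2 * d * (i.mu * i.mubOverMu * i.mub * ((1 - i.mu ^ 2)⁻¹) ^ 2 *
          (i.xiDeltaAbs * (2 * d * i.xiIotaAbs + 2 * d * (i.mu * i.xiIotaAbs) + 2 * d * (i.mu * i.xiIotaAbs) +
              2 * d * (i.mu ^ 2 * i.xiIotaAbs)) +
            i.xiAbs * (2 * d * (i.xiIotaDeltaEi + i.xiIotaAbs) + 2 * d * (i.mu * i.xiIotaDeltaZero + i.mu * i.xiIotaAbs) +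
              2 * d * (i.mu * i.xiIotaDeltaEi) + 2 * d * (i.mu ^ 2 * i.xiIotaDeltaZero)))))

/-! ## Part B. Weighted moment bounds of the pieces ((D.25)–(D.28) bookkeeping) -/

variable (hd : 2 ≤ d) (hp : p < criticalProbI d) (hsc : NobleScalarFacts d p i) (h43 : NobleAssumption43At d p S i)
include hsc h43

/-- Term 2, summed over `ι`. [cite: FitznerVanDerHofstad2016NoBLE, App. D (D.28), (D.29) line 4 (p. 1116)] -/
theorem momentBound_sum_nobleAbsM2 : ∃ L, MomentBound (fun x => ∑ ι : Fin d × Bool, nobleAbsM2 d p i ι x) L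
    (i.mu * i.mubOverMu * (1 - i.mu ^ 2)⁻¹ *
      (2 * d * ((i.xiEvenTailDelta + i.xiOddTailDelta) + (i.xiEvenTail + i.xiOddTail)) +
        i.mu * (2 * d * (i.xiEvenTailDelta + i.xiOddTailDelta)))) := by
  have hc : 0 ≤ i.mu * i.mubOverMu * (1 - i.mu ^ 2)⁻¹ :=
    mul_nonneg (mul_nonneg hsc.imu_nonneg hsc.q_nonneg) hsc.ci_nonneg
  have hT := (momentBound_xiCls_evenTail h43).add (momentBound_xiCls_oddTail h43)
  have h := ((hT.sum_dir_comp_add_stepVec).add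
    ((MomentBound.sum_dir fun _ : Fin d × Bool => hT).const_mul hsc.imu_nonneg)).const_mul hc
  refine ⟨_, h.congr fun x => ?_⟩
  simp only [nobleAbsM2, mul_add, Finset.sum_add_distrib, ← Finset.mul_sum]
  try ring

/-- Term 3 (direction `ι`). [cite: FitznerVanDerHofstad2016NoBLE, Assumption 4.3 (4.44)–(4.45) (p. 1087); App. D (D.29) line 4 (p. 1116)] -/
theorem momentBound_nobleAbsM3 (ι : Fin d × Bool) : MomentBound (nobleAbsM3 S i ι)
    (i.mu * (1 - i.mu ^ 2)⁻¹ * ((i.psiRI0 + i.psiRI1) + i.mu * (i.psiRII0 + i.psiRII1)))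
    (i.mu * (1 - i.mu ^ 2)⁻¹ * ((i.psiRI0Delta + i.psiRI1Delta) + i.mu * (i.psiRII0Delta + i.psiRII1Delta))) :=
  (((((momentBound_of_SumLE_shift (S.psiRI_nonneg zero_le_one ι) (h43.psiRI0 ι) (𝐞 ι) (h43.psiRI0Delta ι)).add
      (momentBound_of_SumLE_shift (S.psiRI_nonneg le_rfl ι) (h43.psiRI1 ι) (𝐞 ι) (h43.psiRI1Delta ι))).add
      (((momentBound_of_SumLE (S.psiRII_nonneg zero_le_one ι) (h43.psiRII0 ι) (h43.psiRII0Delta ι)).add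
        (momentBound_of_SumLE (S.psiRII_nonneg le_rfl ι) (h43.psiRII1 ι) (h43.psiRII1Delta ι))).const_mul
        hsc.imu_nonneg)).const_mul (mul_nonneg hsc.imu_nonneg hsc.ci_nonneg))).congr fun _ => rfl

/-- Term 4, summed over `ι`. [cite: FitznerVanDerHofstad2016NoBLE, Assumption 4.3 (4.33), (4.48)–(4.49) (pp. 1086–1088); App. D (D.28), (D.29) line 5 (p. 1116)] -/
theorem momentBound_sum_nobleAbsM4 : ∃ L, MomentBound (fun x => ∑ ι : Fin d × Bool, nobleAbsM4 S i ι x) L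
    (i.mu * ((1 - i.mu ^ 2)⁻¹) ^ 2 *
      (i.piR0DeltaEiEk + i.mub * (2 * d * (2 * d *
        ((i.xiIotaOddDeltaEi + i.xiIotaEvenTailDeltaEi) + (i.xiIotaOdd + i.xiIotaEvenTail)))))) := by
  have hY : ∀ ι : Fin d × Bool, MomentBound
      (fun x => ∑ κ : Fin d × Bool, (nobleXiIotaCls d p (fun N => 2 * N + 1) (𝐞 ι) (x + 𝐞 κ + 𝐞 ι) +
        nobleXiIotaCls d p (fun N => 2 * N + 2) (𝐞 ι) (x + 𝐞 κ + 𝐞 ι)))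
      (2 * d * (i.xiIotaOdd + i.xiIotaEvenTail))
      (2 * d * ((i.xiIotaOddDeltaEi + i.xiIotaEvenTailDeltaEi) + (i.xiIotaOdd + i.xiIotaEvenTail))) := fun ι =>
    (((momentBound_xiIotaCls_odd_shift h43 ι).add
      (momentBound_xiIotaCls_evenTail_shift h43 ι)).sum_dir_comp_add_stepVec).congr fun _ => rfl
  have h := ((momentBound_sum_piR_shift h43).add ((MomentBound.sum_dir hY).const_mul hsc.imub_nonneg)).const_mul
    (mul_nonneg hsc.imu_nonneg (sq_nonneg ((1 - i.mu ^ 2)⁻¹)))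
  refine ⟨_, h.congr fun x => ?_⟩
  simp only [nobleAbsM4, mul_add, Finset.sum_add_distrib, ← Finset.mul_sum]
  try ring

/-- Term 5 (direction `ι`). [cite: FitznerVanDerHofstad2016NoBLE, App. D (D.28), (D.29) line 6 (p. 1116)] -/
theorem momentBound_nobleAbsM5 (ι : Fin d × Bool) : MomentBound (nobleAbsM5 d p i ι)
    (i.mu ^ 2 * i.mub * ((1 - i.mu ^ 2)⁻¹) ^ 2 *
      (2 * d * i.xiIotaAbs + 2 * d * i.xiIotaAbs + 2 * d * (i.mu * i.xiIotaAbs)))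
    (i.mu ^ 2 * i.mub * ((1 - i.mu ^ 2)⁻¹) ^ 2 *
      (2 * d * (i.xiIotaDeltaZero + i.xiIotaAbs) + 2 * d * i.xiIotaDeltaEi + 2 * d * (i.mu * i.xiIotaDeltaZero))) := by
  have hc : 0 ≤ i.mu ^ 2 * i.mub * ((1 - i.mu ^ 2)⁻¹) ^ 2 :=
    mul_nonneg (mul_nonneg (sq_nonneg _) hsc.imub_nonneg) (sq_nonneg _)
  have h := ((((momentBound_xiIotaCls_abs h43 (srev ι)).sum_dir_comp_add_stepVec).add
    (MomentBound.sum_dir fun _ : Fin d × Bool => momentBound_xiIotaCls_abs_shift h43 ι)).add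
    (MomentBound.sum_dir fun _ : Fin d × Bool =>
      (momentBound_xiIotaCls_abs h43 (srev ι)).const_mul hsc.imu_nonneg)).const_mul hc
  refine h.congr fun x => ?_
  simp only [nobleAbsM5, Finset.sum_add_distrib]

/-- `B^{abs}_ι`: mass `2d(1+μ)²β^abs_{Ξ^ι}`, displacement `2d(1+μ)(β_{ΔΞ^ι,ι} + μβ_{ΔΞ^ι,0} + β_{Ξ^ι})` (written out).
[cite: FitznerVanDerHofstad2016NoBLE, App. D (D.28), (D.29) line 7 (p. 1116)] -/
theorem momentBound_nobleAbsB (ι : Fin d × Bool) : MomentBound (nobleAbsB d p i ι)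
    (2 * d * i.xiIotaAbs + 2 * d * (i.mu * i.xiIotaAbs) + 2 * d * (i.mu * i.xiIotaAbs) +
      2 * d * (i.mu ^ 2 * i.xiIotaAbs))
    (2 * d * (i.xiIotaDeltaEi + i.xiIotaAbs) + 2 * d * (i.mu * i.xiIotaDeltaZero + i.mu * i.xiIotaAbs) +
      2 * d * (i.mu * i.xiIotaDeltaEi) + 2 * d * (i.mu ^ 2 * i.xiIotaDeltaZero)) := by
  have hmu2 : 0 ≤ i.mu ^ 2 := sq_nonneg _
  have h := ((((momentBound_xiIotaCls_abs_shift h43 ι).sum_dir_comp_add_stepVec).add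
    (((momentBound_xiIotaCls_abs h43 (srev ι)).const_mul hsc.imu_nonneg).sum_dir_comp_add_stepVec)).add
    (MomentBound.sum_dir fun _ : Fin d × Bool => (momentBound_xiIotaCls_abs_shift h43 ι).const_mul
      hsc.imu_nonneg)).add
    (MomentBound.sum_dir fun _ : Fin d × Bool => (momentBound_xiIotaCls_abs h43 (srev ι)).const_mul hmu2)
  refine h.congr fun x => ?_
  simp only [nobleAbsB, Finset.sum_add_distrib]

/-- Term 6 (direction `ι`): `Ξ^{[abs]}` is even, so (D.25)–(D.27) apply. [cite: FitznerVanDerHofstad2016NoBLE, App. D (D.25)–(D.28), (D.29) line 7 (p. 1116)] -/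
theorem momentBound_nobleAbsM6 (ι : Fin d × Bool) : MomentBound (nobleAbsM6 d p i ι)
    (i.mu * i.mubOverMu * i.mub * ((1 - i.mu ^ 2)⁻¹) ^ 2 *
      (i.xiAbs * (2 * d * i.xiIotaAbs + 2 * d * (i.mu * i.xiIotaAbs) + 2 * d * (i.mu * i.xiIotaAbs) +
        2 * d * (i.mu ^ 2 * i.xiIotaAbs))))
    (i.mu * i.mubOverMu * i.mub * ((1 - i.mu ^ 2)⁻¹) ^ 2 *
      (i.xiDeltaAbs * (2 * d * i.xiIotaAbs + 2 * d * (i.mu * i.xiIotaAbs) + 2 * d * (i.mu * i.xiIotaAbs) +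
          2 * d * (i.mu ^ 2 * i.xiIotaAbs)) +
        i.xiAbs * (2 * d * (i.xiIotaDeltaEi + i.xiIotaAbs) + 2 * d * (i.mu * i.xiIotaDeltaZero + i.mu * i.xiIotaAbs) +
          2 * d * (i.mu * i.xiIotaDeltaEi) + 2 * d * (i.mu ^ 2 * i.xiIotaDeltaZero)))) :=
  ((((momentBound_xiCls_abs h43).lconv (nobleXiCls_neg _) (momentBound_nobleAbsB hsc h43 ι))).const_mul
    (mul_nonneg (mul_nonneg (mul_nonneg hsc.imu_nonneg hsc.q_nonneg) hsc.imub_nonneg) (sq_nonneg _))).congr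
    fun _ => rfl

/-- **The total weighted moment bound of `m^{abs}`**: `Σ_x ‖x‖₂² m^{abs}(x) ≤ nobleAbsMajW d i`.
[cite: FitznerVanDerHofstad2016NoBLE, App. D Step 4 (D.22)–(D.29) (pp. 1115–1116)] -/
theorem momentBound_nobleAbsMaj (ht1 : nobleMajT d i < 1) :
    ∃ L, MomentBound (nobleAbsMaj S i) L (nobleAbsMajW d i) := by
  obtain ⟨L2, h2⟩ := momentBound_sum_nobleAbsM2 hsc h43
  obtain ⟨L4, h4⟩ := momentBound_sum_nobleAbsM4 hsc h43
  have h := (momentBound_nobleMajM1 hsc h43 ht1).add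
    ((((h2.add (MomentBound.sum_dir fun ι => momentBound_nobleAbsM3 hsc h43 ι)).add h4).add
      (MomentBound.sum_dir fun ι => momentBound_nobleAbsM5 hsc h43 ι)).add
      (MomentBound.sum_dir fun ι => momentBound_nobleAbsM6 hsc h43 ι))
  exact ⟨_, h.congr fun x => by simp only [nobleAbsMaj, Finset.sum_add_distrib]⟩

omit hsc h43 in
/-- **The bookkeeping constant IS the coded (D.29)**: `nobleAbsMajW d i = betaRfDelta[…]` with the arguments of
`BetaMap.extraOfInputs d i 4` (a rational-function identity; needs `μ < 1` and `t < 1` for the denominators).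
[cite: FitznerVanDerHofstad2016NoBLE, App. D (D.29) (p. 1116)] -/
theorem nobleAbsMajW_eq (hsc : NobleScalarFacts d p i) (ht1 : nobleMajT d i < 1) :
    nobleAbsMajW d i = BetaMap.betaRfDelta d i.mu i.mubOverMu i.mub i.xiAbs i.xiDeltaAbs
      (i.xiEvenTail + i.xiOddTail) (i.xiOddTailDelta + i.xiEvenTailDelta) (i.psiRI0Delta + i.psiRI1Delta)
      (i.psiRII0Delta + i.psiRII1Delta) i.xiIotaAbs i.xiIotaDeltaEi i.xiIotaDeltaZero
      (i.xiIotaOdd + i.xiIotaEvenTail) (i.xiIotaOddDeltaEi + i.xiIotaEvenTailDeltaEi) i.piR0DeltaEiEk := by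
  have hμ0 := hsc.imu_nonneg
  have h1 : 1 - i.mu ≠ 0 := (sub_pos.2 hsc.imu_lt_one).ne'
  have h2 : 1 + i.mu ≠ 0 := by positivity
  have h3 : 1 - i.mu ^ 2 ≠ 0 := hsc.one_sub_imu_sq_pos.ne'
  have h1' : 0 < 1 - i.mu := sub_pos.2 hsc.imu_lt_one
  have ht' : 1 - i.mu - 2 * d * i.mub * i.xiIotaAbs ≠ 0 := by
    have ht := ht1
    unfold nobleMajT at ht
    rw [div_mul_eq_mul_div, div_lt_one h1'] at ht
    linarith
  have h4 : 1 - i.mu ^ 2 = (1 - i.mu) * (1 + i.mu) := by ring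
  simp only [nobleAbsMajW, nobleMajW2, nobleMajA2, nobleMajWB, nobleMajT, BetaMap.betaRfDelta]
  rw [h4]
  field_simp
  ring

/-! ## Part C. Pointwise domination `|R_F| ≤ m^{abs}` ([NoBLE17] App. D Step 4, (D.23)–(D.24)) -/

include hd hp

/-- **Term 1**: `Σ_ι |μ(T²_ι + Ψ^ι ⋆ T²_ι)(x)| ≤ M₁(x)`. [cite: FitznerVanDerHofstad2016NoBLE, App. D (D.6)–(D.8) (pp. 1111–1112), (D.29) lines 1–3 (p. 1116)] -/
theorem sum_abs_nobleFRemT1_le_majM1 [NeZero d] (h : NobleL1At d p P X) (ht1 : nobleMajT d i < 1) (x : Site d) :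
    ∑ ι, |nobleFRemT1 d p ι x| ≤ nobleMajM1 d p i x := by
  have hμ0 := hsc.mu_nonneg
  have hq0 := hsc.qp_nonneg
  have hτ := momentBound_nobleMajTau2 hsc h43 ht1
  have hXA := momentBound_xiCls_abs h43
  have hXq : Summable fun y => (p : ℝ) / nobleMu d p * nobleXiCls d p (fun N => N) y := hXA.summable.mul_left _
  have htail := sum_abs_nobleSTail2_le_majTau2 hd hp hsc h43 h ht1
  have hconv : ∀ ι, |lconv (noblePsi d p ι) (nobleSTail2 d p ι) x| ≤
      lconv (fun y => (p : ℝ) / nobleMu d p * nobleXiCls d p (fun N => N) y) (fun y => |nobleSTail2 d p ι y|) x :=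
    fun ι => abs_lconv_le_lconv (abs_noblePsi_le hd hp h43 ι) (fun y => le_rfl) hXq
      (summable_abs_nobleSTail2 h ι) x
  have hsum : ∑ ι, lconv (fun y => (p : ℝ) / nobleMu d p * nobleXiCls d p (fun N => N) y)
        (fun y => |nobleSTail2 d p ι y|) x =
      lconv (fun y => (p : ℝ) / nobleMu d p * nobleXiCls d p (fun N => N) y)
        (fun y => ∑ ι, |nobleSTail2 d p ι y|) x :=
    (lconv_finset_sum_right _ _ (fun ι y => |nobleSTail2 d p ι y|) x fun ι _ =>
      summable_mul_shift_of_abs_le (f := fun y => (p : ℝ) / nobleMu d p * nobleXiCls d p (fun N => N) y)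
        (g := fun y => |nobleSTail2 d p ι y|) hXq.abs
        (abs_le_tsum_of_nonneg (fun _ => abs_nonneg _) (summable_abs_nobleSTail2 h ι)) x).symm
  have hmono : lconv (fun y => (p : ℝ) / nobleMu d p * nobleXiCls d p (fun N => N) y)
        (fun y => ∑ ι, |nobleSTail2 d p ι y|) x ≤
      (p : ℝ) / nobleMu d p * lconv (nobleXiCls d p fun N => N) (nobleMajTau2 d p i) x := by
    rw [← lconv_const_mul_left]
    exact lconv_mono (fun y => mul_nonneg hq0 (nobleXiCls_nonneg _ y)) (fun y => le_rfl)
      (fun y => Finset.sum_nonneg fun ι _ => abs_nonneg _) htail hXq hτ.summable x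
  have hL0 : 0 ≤ lconv (nobleXiCls d p fun N => N) (nobleMajTau2 d p i) x :=
    lconv_nonneg (nobleXiCls_nonneg _) hτ.nonneg x
  have hper : ∀ ι, |nobleFRemT1 d p ι x| ≤ nobleMu d p * (|nobleSTail2 d p ι x| +
      lconv (fun y => (p : ℝ) / nobleMu d p * nobleXiCls d p (fun N => N) y) (fun y => |nobleSTail2 d p ι y|) x) :=
    fun ι => by
      rw [nobleFRemT1, abs_mul, abs_of_nonneg hμ0]
      exact mul_le_mul_of_nonneg_left ((abs_add_le _ _).trans (add_le_add le_rfl (hconv ι))) hμ0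
  calc ∑ ι, |nobleFRemT1 d p ι x|
      ≤ ∑ ι, nobleMu d p * (|nobleSTail2 d p ι x| +
          lconv (fun y => (p : ℝ) / nobleMu d p * nobleXiCls d p (fun N => N) y) (fun y => |nobleSTail2 d p ι y|) x) :=
        Finset.sum_le_sum fun ι _ => hper ι
    _ = nobleMu d p * (∑ ι, |nobleSTail2 d p ι x| + ∑ ι, lconv
          (fun y => (p : ℝ) / nobleMu d p * nobleXiCls d p (fun N => N) y) (fun y => |nobleSTail2 d p ι y|) x) := by
        rw [← Finset.mul_sum, Finset.sum_add_distrib]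
    _ ≤ nobleMu d p * (nobleMajTau2 d p i x +
          (p : ℝ) / nobleMu d p * lconv (nobleXiCls d p fun N => N) (nobleMajTau2 d p i) x) := by
        rw [hsum]
        exact mul_le_mul_of_nonneg_left (add_le_add (htail x) hmono) hμ0
    _ ≤ i.mu * nobleMajTau2 d p i x +
          i.mu * i.mubOverMu * lconv (nobleXiCls d p fun N => N) (nobleMajTau2 d p i) x := by
        rw [mul_add, ← mul_assoc]
        exact add_le_add (mul_le_mul_of_nonneg_right hsc.mu_le (hτ.nonneg x))
          (mul_le_mul_of_nonneg_right hsc.mu_qp_le hL0)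
    _ = nobleMajM1 d p i x := by rw [nobleMajM1]

omit hsc in
/-- `|ΨT_ι(y)| ≤ β_{p/μ_p}(Ξ^{[even≥2]} + Ξ^{[odd≥3]})(y)`. [cite: FitznerVanDerHofstad2016NoBLE, Assumption 4.2 (4.29) (p. 1086); App. D (D.24) (p. 1115)] -/
theorem abs_noblePsiTail2_le (ι : Fin d × Bool) (y : Site d) :
    |noblePsiTail2 d p ι y| ≤ (p : ℝ) / nobleMu d p *
      (nobleXiCls d p (fun N => 2 * N + 2) y + nobleXiCls d p (fun N => 2 * N + 3) y) := by
  have hE := noblePsiCls_nonneg (p := p) (fun N => 2 * N + 2) (𝐞 ι) y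
  have hO := noblePsiCls_nonneg (p := p) (fun N => 2 * N + 3) (𝐞 ι) y
  have hbE := (noblePsiCls_le hd hp h43.xiEvenTail ι y).2
  have hbO := (noblePsiCls_le hd hp h43.xiOddTail ι y).2
  unfold noblePsiTail2
  rw [abs_le, mul_add]
  constructor <;> linarith

/-- **Term 2**: `|μc(ΨT_ι(x+e_ι) − μΨT_ι(x))| ≤ M^{abs}_{2,ι}(x)`. [cite: FitznerVanDerHofstad2016NoBLE, App. D (D.24), (D.29) line 4 (pp. 1115–1116)] -/
theorem abs_nobleFRemT2_le (ι : Fin d × Bool) (x : Site d) : |nobleFRemT2 d p ι x| ≤ nobleAbsM2 d p i ι x := by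
  have hμ0 := hsc.mu_nonneg
  have hc := hsc.c_nonneg
  have h1 := abs_noblePsiTail2_le hd hp h43 ι (x + 𝐞 ι)
  have h2 := abs_noblePsiTail2_le hd hp h43 ι x
  have hX1 : 0 ≤ nobleXiCls d p (fun N => 2 * N + 2) (x + 𝐞 ι) + nobleXiCls d p (fun N => 2 * N + 3) (x + 𝐞 ι) :=
    add_nonneg (nobleXiCls_nonneg _ _) (nobleXiCls_nonneg _ _)
  have hX2 : 0 ≤ nobleXiCls d p (fun N => 2 * N + 2) x + nobleXiCls d p (fun N => 2 * N + 3) x :=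
    add_nonneg (nobleXiCls_nonneg _ _) (nobleXiCls_nonneg _ _)
  calc |nobleFRemT2 d p ι x|
      = nobleMu d p * (1 - nobleMu d p ^ 2)⁻¹ *
          |noblePsiTail2 d p ι (x + 𝐞 ι) - nobleMu d p * noblePsiTail2 d p ι x| := by
        rw [nobleFRemT2, abs_mul, abs_mul, abs_of_nonneg hμ0, abs_of_nonneg hc]
    _ ≤ nobleMu d p * (1 - nobleMu d p ^ 2)⁻¹ *
          ((p : ℝ) / nobleMu d p *
              (nobleXiCls d p (fun N => 2 * N + 2) (x + 𝐞 ι) + nobleXiCls d p (fun N => 2 * N + 3) (x + 𝐞 ι)) +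
            nobleMu d p * ((p : ℝ) / nobleMu d p *
              (nobleXiCls d p (fun N => 2 * N + 2) x + nobleXiCls d p (fun N => 2 * N + 3) x))) := by
        refine mul_le_mul_of_nonneg_left ((abs_sub _ _).trans (add_le_add h1 ?_)) (mul_nonneg hμ0 hc)
        rw [abs_mul, abs_of_nonneg hμ0]
        exact mul_le_mul_of_nonneg_left h2 hμ0
    _ = nobleMu d p * ((p : ℝ) / nobleMu d p) * (1 - nobleMu d p ^ 2)⁻¹ *
          ((nobleXiCls d p (fun N => 2 * N + 2) (x + 𝐞 ι) + nobleXiCls d p (fun N => 2 * N + 3) (x + 𝐞 ι)) +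
            nobleMu d p * (nobleXiCls d p (fun N => 2 * N + 2) x + nobleXiCls d p (fun N => 2 * N + 3) x)) := by
        ring
    _ ≤ i.mu * i.mubOverMu * (1 - i.mu ^ 2)⁻¹ *
          ((nobleXiCls d p (fun N => 2 * N + 2) (x + 𝐞 ι) + nobleXiCls d p (fun N => 2 * N + 3) (x + 𝐞 ι)) +
            i.mu * (nobleXiCls d p (fun N => 2 * N + 2) x + nobleXiCls d p (fun N => 2 * N + 3) x)) :=
        mul_le_mul (mul_le_mul hsc.mu_qp_le hsc.c_le hc (mul_nonneg hsc.imu_nonneg hsc.q_nonneg))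
          (add_le_add le_rfl (mul_le_mul_of_nonneg_right hsc.mu_le hX2)) (add_nonneg hX1 (mul_nonneg hμ0 hX2))
          (mul_nonneg (mul_nonneg hsc.imu_nonneg hsc.q_nonneg) hsc.ci_nonneg)
    _ = nobleAbsM2 d p i ι x := by rw [nobleAbsM2]

omit hd hp h43 in
/-- **Term 3**: `|μc((Ψ^{(0)}_{R,I} − Ψ^{(1)}_{R,I})(x+e_ι) − μ(Ψ^{(0)}_{R,II} − Ψ^{(1)}_{R,II})(x))| ≤ M^{abs}_{3,ι}(x)`.
[cite: FitznerVanDerHofstad2016NoBLE, App. D (D.29) line 4 (p. 1116); Assumption 4.3 (4.44)–(4.45)] -/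
theorem abs_nobleFRemT3_le (ι : Fin d × Bool) (x : Site d) : |nobleFRemT3 S ι x| ≤ nobleAbsM3 S i ι x := by
  have hμ0 := hsc.mu_nonneg
  have hc := hsc.c_nonneg
  have h0' := S.psiRI_nonneg zero_le_one ι (x + 𝐞 ι)
  have h1' := S.psiRI_nonneg le_rfl ι (x + 𝐞 ι)
  have h0 := S.psiRII_nonneg zero_le_one ι x
  have h1 := S.psiRII_nonneg le_rfl ι x
  have hA : |S.psiRI 0 ι (x + 𝐞 ι) - S.psiRI 1 ι (x + 𝐞 ι)| ≤ S.psiRI 0 ι (x + 𝐞 ι) + S.psiRI 1 ι (x + 𝐞 ι) := by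
    rw [abs_le]; constructor <;> linarith
  have hB : |S.psiRII 0 ι x - S.psiRII 1 ι x| ≤ S.psiRII 0 ι x + S.psiRII 1 ι x := by
    rw [abs_le]; constructor <;> linarith
  calc |nobleFRemT3 S ι x|
      = nobleMu d p * (1 - nobleMu d p ^ 2)⁻¹ *
          |(S.psiRI 0 ι (x + 𝐞 ι) - S.psiRI 1 ι (x + 𝐞 ι)) - nobleMu d p * (S.psiRII 0 ι x - S.psiRII 1 ι x)| := by
        rw [nobleFRemT3, abs_mul, abs_mul, abs_of_nonneg hμ0, abs_of_nonneg hc]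
    _ ≤ nobleMu d p * (1 - nobleMu d p ^ 2)⁻¹ *
          ((S.psiRI 0 ι (x + 𝐞 ι) + S.psiRI 1 ι (x + 𝐞 ι)) + nobleMu d p * (S.psiRII 0 ι x + S.psiRII 1 ι x)) := by
        refine mul_le_mul_of_nonneg_left ((abs_sub _ _).trans (add_le_add hA ?_)) (mul_nonneg hμ0 hc)
        rw [abs_mul, abs_of_nonneg hμ0]
        exact mul_le_mul_of_nonneg_left hB hμ0
    _ ≤ i.mu * (1 - i.mu ^ 2)⁻¹ *
          ((S.psiRI 0 ι (x + 𝐞 ι) + S.psiRI 1 ι (x + 𝐞 ι)) + i.mu * (S.psiRII 0 ι x + S.psiRII 1 ι x)) :=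
        mul_le_mul hsc.mu_c_le (add_le_add le_rfl (mul_le_mul_of_nonneg_right hsc.mu_le (add_nonneg h0 h1)))
          (add_nonneg (add_nonneg h0' h1') (mul_nonneg hμ0 (add_nonneg h0 h1)))
          (mul_nonneg hsc.imu_nonneg hsc.ci_nonneg)
    _ = nobleAbsM3 S i ι x := by rw [nobleAbsM3]

/-- **Term 4**: `|μc² Σ_κ (Π^{(0),ι,κ}_R − ΠT_{ι,κ})(x+e_ι+e_κ)| ≤ M^{abs}_{4,ι}(x)`.
[cite: FitznerVanDerHofstad2016NoBLE, App. D (D.24), (D.29) line 5 (pp. 1115–1116); Assumption 4.3 (4.48)] -/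
theorem abs_nobleFRemT4_le (ι : Fin d × Bool) (x : Site d) : |nobleFRemT4 S ι x| ≤ nobleAbsM4 S i ι x := by
  have hμ0 := hsc.mu_nonneg
  have hc2 : 0 ≤ ((1 - nobleMu d p ^ 2)⁻¹) ^ 2 := sq_nonneg _
  have hp0 := hsc.pbar_nonneg
  have hO1 : ∀ κ, 0 ≤ noblePiCls d p (fun N => 2 * N + 1) (𝐞 ι) (𝐞 κ) (x + 𝐞 ι + 𝐞 κ) := fun κ =>
    noblePiCls_nonneg _ _ _ _
  have hE2 : ∀ κ, 0 ≤ noblePiCls d p (fun N => 2 * N + 2) (𝐞 ι) (𝐞 κ) (x + 𝐞 ι + 𝐞 κ) := fun κ =>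
    noblePiCls_nonneg _ _ _ _
  have hR : ∀ κ, 0 ≤ S.piR ι κ (x + 𝐞 ι + 𝐞 κ) := fun κ => S.piR_nonneg ι κ _
  have hY : ∀ κ, 0 ≤ nobleXiIotaCls d p (fun N => 2 * N + 1) (𝐞 ι) (x + 𝐞 κ + 𝐞 ι) +
      nobleXiIotaCls d p (fun N => 2 * N + 2) (𝐞 ι) (x + 𝐞 κ + 𝐞 ι) := fun κ =>
    add_nonneg (nobleXiIotaCls_nonneg _ _ _) (nobleXiIotaCls_nonneg _ _ _)
  have hO : ∀ κ, noblePiCls d p (fun N => 2 * N + 1) (𝐞 ι) (𝐞 κ) (x + 𝐞 ι + 𝐞 κ) ≤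
      (p : ℝ) * nobleXiIotaCls d p (fun N => 2 * N + 1) (𝐞 ι) (x + 𝐞 κ + 𝐞 ι) := fun κ => by
    have h := (noblePiCls_le hd hp ι (h43.xiIotaOdd ι) κ (x + 𝐞 ι + 𝐞 κ)).2
    rwa [add_right_comm x (𝐞 ι) (𝐞 κ)] at h ⊢
  have hE : ∀ κ, noblePiCls d p (fun N => 2 * N + 2) (𝐞 ι) (𝐞 κ) (x + 𝐞 ι + 𝐞 κ) ≤
      (p : ℝ) * nobleXiIotaCls d p (fun N => 2 * N + 2) (𝐞 ι) (x + 𝐞 κ + 𝐞 ι) := fun κ => by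
    have h := (noblePiCls_le hd hp ι (h43.xiIotaEvenTail ι) κ (x + 𝐞 ι + 𝐞 κ)).2
    rwa [add_right_comm x (𝐞 ι) (𝐞 κ)] at h ⊢
  have hk : ∀ κ, |S.piR ι κ (x + 𝐞 ι + 𝐞 κ) - noblePiTail1 d p ι κ (x + 𝐞 ι + 𝐞 κ)| ≤
      S.piR ι κ (x + 𝐞 ι + 𝐞 κ) +
        ((p : ℝ) * nobleXiIotaCls d p (fun N => 2 * N + 1) (𝐞 ι) (x + 𝐞 κ + 𝐞 ι) +
          (p : ℝ) * nobleXiIotaCls d p (fun N => 2 * N + 2) (𝐞 ι) (x + 𝐞 κ + 𝐞 ι)) := fun κ => by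
    have := hO κ; have := hE κ; have := hR κ; have := hO1 κ; have := hE2 κ
    unfold noblePiTail1
    rw [abs_le]; constructor <;> linarith
  have hS : ∑ κ : Fin d × Bool, (S.piR ι κ (x + 𝐞 ι + 𝐞 κ) +
        ((p : ℝ) * nobleXiIotaCls d p (fun N => 2 * N + 1) (𝐞 ι) (x + 𝐞 κ + 𝐞 ι) +
          (p : ℝ) * nobleXiIotaCls d p (fun N => 2 * N + 2) (𝐞 ι) (x + 𝐞 κ + 𝐞 ι))) =
      (∑ κ : Fin d × Bool, S.piR ι κ (x + 𝐞 ι + 𝐞 κ)) +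
        (p : ℝ) * ∑ κ : Fin d × Bool, (nobleXiIotaCls d p (fun N => 2 * N + 1) (𝐞 ι) (x + 𝐞 κ + 𝐞 ι) +
          nobleXiIotaCls d p (fun N => 2 * N + 2) (𝐞 ι) (x + 𝐞 κ + 𝐞 ι)) := by
    rw [Finset.sum_add_distrib, Finset.mul_sum]
    exact congrArg _ (Finset.sum_congr rfl fun κ _ => by ring)
  calc |nobleFRemT4 S ι x|
      = nobleMu d p * ((1 - nobleMu d p ^ 2)⁻¹) ^ 2 *
          |∑ κ : Fin d × Bool, (S.piR ι κ (x + 𝐞 ι + 𝐞 κ) - noblePiTail1 d p ι κ (x + 𝐞 ι + 𝐞 κ))| := by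
        rw [nobleFRemT4, abs_neg, abs_mul, abs_mul, abs_of_nonneg hμ0, abs_of_nonneg hc2]
    _ ≤ nobleMu d p * ((1 - nobleMu d p ^ 2)⁻¹) ^ 2 *
          ((∑ κ : Fin d × Bool, S.piR ι κ (x + 𝐞 ι + 𝐞 κ)) +
            (p : ℝ) * ∑ κ : Fin d × Bool, (nobleXiIotaCls d p (fun N => 2 * N + 1) (𝐞 ι) (x + 𝐞 κ + 𝐞 ι) +
              nobleXiIotaCls d p (fun N => 2 * N + 2) (𝐞 ι) (x + 𝐞 κ + 𝐞 ι))) := by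
        rw [← hS]
        exact mul_le_mul_of_nonneg_left ((Finset.abs_sum_le_sum_abs _ _).trans
          (Finset.sum_le_sum fun κ _ => hk κ)) (mul_nonneg hμ0 hc2)
    _ ≤ i.mu * ((1 - i.mu ^ 2)⁻¹) ^ 2 *
          ((∑ κ : Fin d × Bool, S.piR ι κ (x + 𝐞 ι + 𝐞 κ)) +
            i.mub * ∑ κ : Fin d × Bool, (nobleXiIotaCls d p (fun N => 2 * N + 1) (𝐞 ι) (x + 𝐞 κ + 𝐞 ι) +
              nobleXiIotaCls d p (fun N => 2 * N + 2) (𝐞 ι) (x + 𝐞 κ + 𝐞 ι))) :=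
        mul_le_mul (mul_le_mul hsc.mu_le hsc.c_sq_le hc2 hsc.imu_nonneg)
          (add_le_add le_rfl (mul_le_mul_of_nonneg_right hsc.pbar_le (Finset.sum_nonneg fun κ _ => hY κ)))
          (add_nonneg (Finset.sum_nonneg fun κ _ => hR κ) (mul_nonneg hp0 (Finset.sum_nonneg fun κ _ => hY κ)))
          (mul_nonneg hsc.imu_nonneg (sq_nonneg _))
    _ = nobleAbsM4 S i ι x := by rw [nobleAbsM4]

/-- **Term 5**: `|μ²c² Σ_κ (Π^{−ι,κ}(x+e_κ) + Π^{ι,κ}(x+e_ι) − μΠ^{−ι,κ}(x))| ≤ M^{abs}_{5,ι}(x)`.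
[cite: FitznerVanDerHofstad2016NoBLE, App. D (D.24), (D.29) line 6 (pp. 1115–1116)] -/
theorem abs_nobleFRemT5_le (ι : Fin d × Bool) (x : Site d) : |nobleFRemT5 d p ι x| ≤ nobleAbsM5 d p i ι x := by
  have hμ0 := hsc.mu_nonneg
  have hc2 : 0 ≤ ((1 - nobleMu d p ^ 2)⁻¹) ^ 2 := sq_nonneg _
  have hp0 := hsc.pbar_nonneg
  have hY : ∀ (e : Fin d × Bool) (y : Site d), 0 ≤ nobleXiIotaCls d p (fun N => N) (𝐞 e) y :=
    fun e y => nobleXiIotaCls_nonneg _ _ _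
  have hPi : ∀ (e κ : Fin d × Bool) (y : Site d), |noblePi d p e κ y| ≤
      (p : ℝ) * nobleXiIotaCls d p (fun N => N) (𝐞 e) y := fun e κ y => abs_noblePi_le hd hp h43 e κ y
  have hk : ∀ κ, |noblePi d p (srev ι) κ (x + 𝐞 κ) + noblePi d p ι κ (x + 𝐞 ι) -
      nobleMu d p * noblePi d p (srev ι) κ x| ≤
      (p : ℝ) * nobleXiIotaCls d p (fun N => N) (𝐞 (srev ι)) (x + 𝐞 κ) +
        (p : ℝ) * nobleXiIotaCls d p (fun N => N) (𝐞 ι) (x + 𝐞 ι) +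
        nobleMu d p * ((p : ℝ) * nobleXiIotaCls d p (fun N => N) (𝐞 (srev ι)) x) := fun κ => by
    refine (abs_sub _ _).trans (add_le_add ((abs_add_le _ _).trans (add_le_add (hPi _ _ _) (hPi _ _ _))) ?_)
    rw [abs_mul, abs_of_nonneg hμ0]
    exact mul_le_mul_of_nonneg_left (hPi _ _ _) hμ0
  calc |nobleFRemT5 d p ι x|
      = nobleMu d p ^ 2 * ((1 - nobleMu d p ^ 2)⁻¹) ^ 2 *
          |∑ κ : Fin d × Bool, (noblePi d p (srev ι) κ (x + 𝐞 κ) + noblePi d p ι κ (x + 𝐞 ι) -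
            nobleMu d p * noblePi d p (srev ι) κ x)| := by
        rw [nobleFRemT5, abs_mul, abs_mul, abs_of_nonneg (sq_nonneg _), abs_of_nonneg hc2]
    _ ≤ nobleMu d p ^ 2 * ((1 - nobleMu d p ^ 2)⁻¹) ^ 2 * ∑ κ : Fin d × Bool,
          ((p : ℝ) * nobleXiIotaCls d p (fun N => N) (𝐞 (srev ι)) (x + 𝐞 κ) +
            (p : ℝ) * nobleXiIotaCls d p (fun N => N) (𝐞 ι) (x + 𝐞 ι) +
            nobleMu d p * ((p : ℝ) * nobleXiIotaCls d p (fun N => N) (𝐞 (srev ι)) x)) :=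
        mul_le_mul_of_nonneg_left ((Finset.abs_sum_le_sum_abs _ _).trans (Finset.sum_le_sum fun κ _ => hk κ))
          (mul_nonneg (sq_nonneg _) hc2)
    _ = nobleMu d p ^ 2 * (p : ℝ) * ((1 - nobleMu d p ^ 2)⁻¹) ^ 2 * ∑ κ : Fin d × Bool,
          (nobleXiIotaCls d p (fun N => N) (𝐞 (srev ι)) (x + 𝐞 κ) + nobleXiIotaCls d p (fun N => N) (𝐞 ι) (x + 𝐞 ι) +
            nobleMu d p * nobleXiIotaCls d p (fun N => N) (𝐞 (srev ι)) x) := by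
        simp only [Finset.mul_sum]
        exact Finset.sum_congr rfl fun κ _ => by ring
    _ ≤ i.mu ^ 2 * i.mub * ((1 - i.mu ^ 2)⁻¹) ^ 2 * ∑ κ : Fin d × Bool,
          (nobleXiIotaCls d p (fun N => N) (𝐞 (srev ι)) (x + 𝐞 κ) + nobleXiIotaCls d p (fun N => N) (𝐞 ι) (x + 𝐞 ι) +
            i.mu * nobleXiIotaCls d p (fun N => N) (𝐞 (srev ι)) x) :=
        mul_le_mul (mul_le_mul (mul_le_mul hsc.mu_sq_le hsc.pbar_le hp0 (sq_nonneg _)) hsc.c_sq_le hc2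
          (mul_nonneg (sq_nonneg _) hsc.imub_nonneg))
          (Finset.sum_le_sum fun κ _ => add_le_add le_rfl (mul_le_mul_of_nonneg_right hsc.mu_le (hY _ _)))
          (Finset.sum_nonneg fun κ _ => add_nonneg (add_nonneg (hY _ _) (hY _ _)) (mul_nonneg hμ0 (hY _ _)))
          (mul_nonneg (mul_nonneg (sq_nonneg _) hsc.imub_nonneg) (sq_nonneg _))
    _ = nobleAbsM5 d p i ι x := by rw [nobleAbsM5]

/-- `|(A u)_ι(z)| ≤ (1−μ_p²)⁻² μ̄_p B^{abs}_ι(z)`. [cite: FitznerVanDerHofstad2016NoBLE, §4.1.2 (4.10) (p. 1082); App. D (D.24) (p. 1115)] -/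
theorem abs_nobleAU_le (ι : Fin d × Bool) (z : Site d) :
    |nobleAU d p ι z| ≤ ((1 - nobleMu d p ^ 2)⁻¹) ^ 2 * (p : ℝ) * nobleAbsB d p i ι z := by
  have hμ0 := hsc.mu_nonneg
  have hc2 : 0 ≤ ((1 - nobleMu d p ^ 2)⁻¹) ^ 2 := sq_nonneg _
  have hp0 := hsc.pbar_nonneg
  have hY : ∀ (e : Fin d × Bool) (y : Site d), 0 ≤ nobleXiIotaCls d p (fun N => N) (𝐞 e) y :=
    fun e y => nobleXiIotaCls_nonneg _ _ _
  have hPi : ∀ (e κ : Fin d × Bool) (y : Site d), |noblePi d p e κ y| ≤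
      (p : ℝ) * nobleXiIotaCls d p (fun N => N) (𝐞 e) y := fun e κ y => abs_noblePi_le hd hp h43 e κ y
  have hk : ∀ κ, |noblePi d p ι κ (z + 𝐞 ι + 𝐞 κ) - nobleMu d p * noblePi d p (srev ι) κ (z + 𝐞 κ) -
      nobleMu d p * noblePi d p ι κ (z + 𝐞 ι) + nobleMu d p ^ 2 * noblePi d p (srev ι) κ z| ≤
      (p : ℝ) * nobleXiIotaCls d p (fun N => N) (𝐞 ι) (z + 𝐞 κ + 𝐞 ι) +
        i.mu * ((p : ℝ) * nobleXiIotaCls d p (fun N => N) (𝐞 (srev ι)) (z + 𝐞 κ)) +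
        i.mu * ((p : ℝ) * nobleXiIotaCls d p (fun N => N) (𝐞 ι) (z + 𝐞 ι)) +
        i.mu ^ 2 * ((p : ℝ) * nobleXiIotaCls d p (fun N => N) (𝐞 (srev ι)) z) := fun κ => by
    have h1 : |noblePi d p ι κ (z + 𝐞 ι + 𝐞 κ)| ≤ (p : ℝ) * nobleXiIotaCls d p (fun N => N) (𝐞 ι) (z + 𝐞 κ + 𝐞 ι) := by
      have h := hPi ι κ (z + 𝐞 ι + 𝐞 κ)
      rwa [add_right_comm z (𝐞 ι) (𝐞 κ)] at h ⊢
    have h2 : |nobleMu d p * noblePi d p (srev ι) κ (z + 𝐞 κ)| ≤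
        i.mu * ((p : ℝ) * nobleXiIotaCls d p (fun N => N) (𝐞 (srev ι)) (z + 𝐞 κ)) := by
      rw [abs_mul, abs_of_nonneg hμ0]
      exact (mul_le_mul_of_nonneg_left (hPi _ _ _) hμ0).trans
        (mul_le_mul_of_nonneg_right hsc.mu_le (mul_nonneg hp0 (hY _ _)))
    have h3 : |nobleMu d p * noblePi d p ι κ (z + 𝐞 ι)| ≤
        i.mu * ((p : ℝ) * nobleXiIotaCls d p (fun N => N) (𝐞 ι) (z + 𝐞 ι)) := by
      rw [abs_mul, abs_of_nonneg hμ0]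
      exact (mul_le_mul_of_nonneg_left (hPi _ _ _) hμ0).trans
        (mul_le_mul_of_nonneg_right hsc.mu_le (mul_nonneg hp0 (hY _ _)))
    have h4 : |nobleMu d p ^ 2 * noblePi d p (srev ι) κ z| ≤
        i.mu ^ 2 * ((p : ℝ) * nobleXiIotaCls d p (fun N => N) (𝐞 (srev ι)) z) := by
      rw [abs_mul, abs_of_nonneg (sq_nonneg _)]
      exact (mul_le_mul_of_nonneg_left (hPi _ _ _) (sq_nonneg _)).trans
        (mul_le_mul_of_nonneg_right hsc.mu_sq_le (mul_nonneg hp0 (hY _ _)))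
    have a1 := abs_le.1 h1; have a2 := abs_le.1 h2; have a3 := abs_le.1 h3; have a4 := abs_le.1 h4
    rw [abs_le]
    constructor <;> linarith [a1.1, a1.2, a2.1, a2.2, a3.1, a3.2, a4.1, a4.2]
  calc |nobleAU d p ι z|
      = ((1 - nobleMu d p ^ 2)⁻¹) ^ 2 * |∑ κ : Fin d × Bool,
          (noblePi d p ι κ (z + 𝐞 ι + 𝐞 κ) - nobleMu d p * noblePi d p (srev ι) κ (z + 𝐞 κ) -
            nobleMu d p * noblePi d p ι κ (z + 𝐞 ι) + nobleMu d p ^ 2 * noblePi d p (srev ι) κ z)| := by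
        rw [nobleAU, abs_mul, abs_of_nonneg hc2]
    _ ≤ ((1 - nobleMu d p ^ 2)⁻¹) ^ 2 * ∑ κ : Fin d × Bool,
          ((p : ℝ) * nobleXiIotaCls d p (fun N => N) (𝐞 ι) (z + 𝐞 κ + 𝐞 ι) +
            i.mu * ((p : ℝ) * nobleXiIotaCls d p (fun N => N) (𝐞 (srev ι)) (z + 𝐞 κ)) +
            i.mu * ((p : ℝ) * nobleXiIotaCls d p (fun N => N) (𝐞 ι) (z + 𝐞 ι)) +
            i.mu ^ 2 * ((p : ℝ) * nobleXiIotaCls d p (fun N => N) (𝐞 (srev ι)) z)) :=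
        mul_le_mul_of_nonneg_left ((Finset.abs_sum_le_sum_abs _ _).trans (Finset.sum_le_sum fun κ _ => hk κ)) hc2
    _ = ((1 - nobleMu d p ^ 2)⁻¹) ^ 2 * (p : ℝ) * nobleAbsB d p i ι z := by
        rw [nobleAbsB]
        simp only [Finset.mul_sum]
        exact Finset.sum_congr rfl fun κ _ => by ring

/-- **Term 6**: `|μ(Ψ^ι ⋆ (A u)_ι)(x)| ≤ M^{abs}_{6,ι}(x)` ((D.23)–(D.27) with `|Ψ^ι| ≤ β_{μ̄/μ}Ξ^{[abs]}`, `|(Au)_ι| ≤ c²μ̄B^{abs}_ι`).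
[cite: FitznerVanDerHofstad2016NoBLE, App. D (D.23)–(D.28), (D.29) line 7 (pp. 1115–1116)] -/
theorem abs_nobleFRemT6_le (ι : Fin d × Bool) (x : Site d) : |nobleFRemT6 d p ι x| ≤ nobleAbsM6 d p i ι x := by
  have hμ0 := hsc.mu_nonneg
  have hc2 : 0 ≤ ((1 - nobleMu d p ^ 2)⁻¹) ^ 2 := sq_nonneg _
  have hp0 := hsc.pbar_nonneg
  have hB := momentBound_nobleAbsB hsc h43 ι
  have hXA := momentBound_xiCls_abs h43
  have hconv : |lconv (noblePsi d p ι) (nobleAU d p ι) x| ≤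
      lconv (fun y => (p : ℝ) / nobleMu d p * nobleXiCls d p (fun N => N) y)
        (fun z => ((1 - nobleMu d p ^ 2)⁻¹) ^ 2 * (p : ℝ) * nobleAbsB d p i ι z) x :=
    abs_lconv_le_lconv (abs_noblePsi_le hd hp h43 ι) (abs_nobleAU_le hd hp hsc h43 ι) (hXA.summable.mul_left _)
      (hB.summable.mul_left _) x
  rw [lconv_const_mul_left, lconv_const_mul_right] at hconv
  have hL0 : 0 ≤ lconv (nobleXiCls d p fun N => N) (nobleAbsB d p i ι) x :=
    lconv_nonneg (nobleXiCls_nonneg (p := p) fun N => N) hB.nonneg x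
  calc |nobleFRemT6 d p ι x| = nobleMu d p * |lconv (noblePsi d p ι) (nobleAU d p ι) x| := by
        rw [nobleFRemT6, abs_neg, abs_mul, abs_of_nonneg hμ0]
    _ ≤ nobleMu d p * ((p : ℝ) / nobleMu d p * (((1 - nobleMu d p ^ 2)⁻¹) ^ 2 * (p : ℝ) *
          lconv (nobleXiCls d p fun N => N) (nobleAbsB d p i ι) x)) := mul_le_mul_of_nonneg_left hconv hμ0
    _ = nobleMu d p * ((p : ℝ) / nobleMu d p) * ((1 - nobleMu d p ^ 2)⁻¹) ^ 2 * (p : ℝ) *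
          lconv (nobleXiCls d p fun N => N) (nobleAbsB d p i ι) x := by ring
    _ ≤ i.mu * i.mubOverMu * ((1 - i.mu ^ 2)⁻¹) ^ 2 * i.mub *
          lconv (nobleXiCls d p fun N => N) (nobleAbsB d p i ι) x :=
        mul_le_mul_of_nonneg_right (mul_le_mul (mul_le_mul hsc.mu_qp_le hsc.c_sq_le hc2
          (mul_nonneg hsc.imu_nonneg hsc.q_nonneg)) hsc.pbar_le hp0
          (mul_nonneg (mul_nonneg hsc.imu_nonneg hsc.q_nonneg) (sq_nonneg _))) hL0
    _ = nobleAbsM6 d p i ι x := by rw [nobleAbsM6]; ring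

/-- **`|Σ_ι R^F_ι(x)| ≤ m^{abs}(x)`**: the six term bounds summed. [cite: FitznerVanDerHofstad2016NoBLE, App. D Step 4 (D.22)–(D.29) (pp. 1115–1116)] -/
theorem abs_sum_dirRem_le_absMaj [NeZero d] (h : NobleL1At d p P X) (ht1 : nobleMajT d i < 1) (x : Site d) :
    |∑ ι, nobleFDirRem S ι x| ≤ nobleAbsMaj S i x := by
  have h1 := sum_abs_nobleFRemT1_le_majM1 hd hp hsc h43 h ht1 x
  have h2 := fun ι => abs_nobleFRemT2_le hd hp hsc h43 ι x
  have h3 := fun ι => abs_nobleFRemT3_le hsc (S := S) ι x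
  have h4 := fun ι => abs_nobleFRemT4_le hd hp hsc h43 ι x
  have h5 := fun ι => abs_nobleFRemT5_le hd hp hsc h43 ι x
  have h6 := fun ι => abs_nobleFRemT6_le hd hp hsc h43 ι x
  have hs : ∑ ι, nobleFDirRem S ι x = (∑ ι, nobleFRemT1 d p ι x) +
      ∑ ι, (nobleFRemT2 d p ι x + nobleFRemT3 S ι x + nobleFRemT4 S ι x + nobleFRemT5 d p ι x + nobleFRemT6 d p ι x) := by
    rw [← Finset.sum_add_distrib]
    exact Finset.sum_congr rfl fun ι _ => by unfold nobleFDirRem; ring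
  rw [hs, nobleAbsMaj]
  refine (abs_add_le _ _).trans (add_le_add ((Finset.abs_sum_le_sum_abs _ _).trans h1)
    ((Finset.abs_sum_le_sum_abs _ _).trans (Finset.sum_le_sum fun ι _ => ?_)))
  exact (abs_add_le _ _).trans (add_le_add ((abs_add_le _ _).trans (add_le_add ((abs_add_le _ _).trans (add_le_add
    ((abs_add_le _ _).trans (add_le_add (h2 ι) (h3 ι))) (h4 ι))) (h5 ι))) (h6 ι))

/-- **`|R_F| ≤ m^{abs}` pointwise.** [cite: FitznerVanDerHofstad2016NoBLE, App. D Step 4 (D.22)–(D.29) (pp. 1115–1116)] -/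
theorem abs_nobleFRem_le_absMaj [NeZero d] (h : NobleL1At d p P X) (hT : IsTRS (nobleFAlpha S))
    (ht1 : nobleMajT d i < 1) (x : Site d) : |nobleFRem S x| ≤ nobleAbsMaj S i x := by
  rw [nobleFRem_eq_sum_dirRem hd hp h h43 hT x]
  exact abs_sum_dirRem_le_absMaj hd hp hsc h43 h ht1 x

end AbsMajorant

/-! ## Part D. (D.29) as a theorem -/

section D29

local notation "𝐞" => Literature.Probability.Percolation.stepVec

variable {p : unitInterval} {i : BetaMap.Inputs} {S : NobleSplit d p}

/-- Slot `4` of `BetaMap.extraOfInputs` is the coded `betaRfDelta[…]`. [cite: FitznerVanDerHofstad2016NoBLE, App. D (D.29) (p. 1116)] -/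
theorem BetaMap.extraOfInputs_four (d : ℝ) (i : BetaMap.Inputs) :
    BetaMap.extraOfInputs d i 4 = BetaMap.betaRfDelta d i.mu i.mubOverMu i.mub i.xiAbs i.xiDeltaAbs
      (i.xiEvenTail + i.xiOddTail) (i.xiOddTailDelta + i.xiEvenTailDelta) (i.psiRI0Delta + i.psiRI1Delta)
      (i.psiRII0Delta + i.psiRII1Delta) i.xiIotaAbs i.xiIotaDeltaEi i.xiIotaDeltaZero
      (i.xiIotaOdd + i.xiIotaEvenTail) (i.xiIotaOddDeltaEi + i.xiIotaEvenTailDeltaEi) i.piR0DeltaEiEk := rfl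

variable (hd : 2 ≤ d) (hp : p < criticalProbI d)
include hd hp

/-- **[NoBLE17, App. D (D.29) — bookkeeping form].** Under Assumption 4.3 with well-formed constants `i` (at
`0 < p < p_c`) and the total rotational symmetry of the local part `F_α` (automatic for percolation,
`isTRS_nobleFAlpha`): `Σ_x ‖x‖₂² |R_F(x)|` converges and is at most `nobleAbsMajW d i`.
[cite: FitznerVanDerHofstad2016NoBLE, App. D Step 4 (D.22)–(D.29) (pp. 1115–1116)] -/
theorem nobleFRem_weighted_le (hp0 : 0 < (p : ℝ)) (hWF : NobleInputsWF d i) (h43 : NobleAssumption43At d p S i)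
    (hT : IsTRS (nobleFAlpha S)) :
    (Summable fun x => normSq x * |nobleFRem S x|) ∧ ∑' x, normSq x * |nobleFRem S x| ≤ nobleAbsMajW d i := by
  haveI : NeZero d := ⟨by omega⟩
  have hsc := nobleScalarFacts_of hd hp hp0 hWF h43
  have ht1 : nobleMajT d i < 1 := hWF.1.tmp2_lt_one
  have h := nobleL1At_of_assumption43 hd hp hp0 h43
  obtain ⟨L, hm⟩ := momentBound_nobleAbsMaj hsc h43 ht1
  have hdom : ∀ x, |nobleFRem S x| ≤ nobleAbsMaj S i x := abs_nobleFRem_le_absMaj hd hp hsc h43 h hT ht1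
  have hns : ∀ x : Site d, normSq x = euclidNorm x ^ 2 := fun x => by
    rw [euclidNorm, Real.sq_sqrt (Finset.sum_nonneg fun i _ => sq_nonneg _)]; rfl
  have h0 : ∀ x, 0 ≤ normSq x * |nobleFRem S x| := fun x => by
    rw [hns x]; exact mul_nonneg (sq_nonneg _) (abs_nonneg _)
  have hle : ∀ x, normSq x * |nobleFRem S x| ≤ euclidNorm x ^ 2 * nobleAbsMaj S i x := fun x => by
    rw [hns x]
    exact mul_le_mul_of_nonneg_left (hdom x) (sq_nonneg _)
  have hs : Summable fun x => normSq x * |nobleFRem S x| := Summable.of_nonneg_of_le h0 hle hm.summableW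
  exact ⟨hs, (hs.tsum_le_tsum hle hm.summableW).trans hm.tsumW_le⟩

/-- **[NoBLE17, App. D (D.29) — theorem].** Under Assumption 4.3 with well-formed constants `i` (at `0 < p < p_c`)
and the total rotational symmetry of `F_α`: `Σ_x ‖x‖₂² |R_F(x)| ≤ β_{|ΔR,F|}(i) = BetaMap.extraOfInputs d i 4` — the
hypothesis (D.29) of `nobleSimplifiedFormF3At_of_assumptions₆` discharged, verbatim for the coded constant.
[cite: FitznerVanDerHofstad2016NoBLE, App. D Step 4 (D.22)–(D.29) (pp. 1115–1116); Assumption 4.3 (4.44)–(4.49) (pp. 1087–1088)] -/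
theorem nobleFRem_weighted (hp0 : 0 < (p : ℝ)) (hWF : NobleInputsWF d i) (h43 : NobleAssumption43At d p S i)
    (hT : IsTRS (nobleFAlpha S)) :
    (Summable fun x => normSq x * |nobleFRem S x|) ∧
      ∑' x, normSq x * |nobleFRem S x| ≤ BetaMap.extraOfInputs d i 4 := by
  obtain ⟨hs, hle⟩ := nobleFRem_weighted_le hd hp hp0 hWF h43 hT
  refine ⟨hs, hle.trans (le_of_eq ?_)⟩
  rw [BetaMap.extraOfInputs_four]
  exact nobleAbsMajW_eq (nobleScalarFacts_of hd hp hp0 hWF h43) hWF.1.tmp2_lt_one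

end D29

end Literature.Probability.FitznerVanDerHofstad2017
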